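import Summits.SmoothPoincare4.SmoothPoincare4.Theses.EntropyRung
import Literature.Geometry.Riemannian.PerelmanEntropyCutoff
import Literature.Geometry.Riemannian.BakryEmeryHeatFlow
import Literature.Geometry.Lorentzian.GreenIdentity
import Literature.Geometry.Lorentzian.CurvatureRegularity
import Mathlib.Analysis.SpecialFunctions.Log.NegMulLog
import HarnessLib

/-!
# From Perelman's `𝒲`-clause over smooth `f` to the clause over smooth test functions `w²`
(helper H2 for stub `stub_conformalGluing` of line `green-blowup-conformal-entropy`, crux
`EntropyRung.SubcylindricalExistence`, item stmt-SmoothPoincare4-10871)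

The crux ENT, RoundBound and every entropy clause of the route are written over smooth `f` with
`e^{-f} > 0`: `∀ f ∈ C^∞(M), ∫ c e^{-f} dV = 1 → L ≤ ∫ [τ(R + |∇f|²) + f − 4] c e^{-f} dV`
(`c = (4πτ)⁻²`). Localisation arguments (IMS cut-offs, helper H1
`EntropyRungSubcylindricalExistenceEntropyLocalisation.lean`) produce test functions `w = χ v` WITH
ZEROS, for which one needs the clause in the `w²`-form
`∫ c w² dV = 1 → L ≤ ∫ [τ(R w² + 4|∇w|²) − w² log w² − 4 w²] c dV`. We prove that the `f`-form at a
fixed `τ > 0` implies the `w²`-form at the same `τ` (`wClause_sq_of_wClause_exp`): test the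
`f`-clause on `f_ε = −log((1−ε) w² + ε/V)`, `V = ∫ c dV` (smooth, positive inside the log,
normalised), use `|∇f_ε|² e^{-f_ε} = |∇q_ε|²/q_ε ≤ 4|∇w|²` (`q_ε = (1−ε)w² + ε/V`; Topping's
substitution (8.1.8), `gradSq_const_sub_log_comp`, `gradSq_sq_add_const`), and let `ε → 0` by
dominated convergence. This is the standard "approximation" remark in Perelman 2002 §3.1 /
Topping 2006 proof of Lemma 8.3.5 ("by approximation, (8.3.5)"), made explicit.
-/

noncomputable section

-- the registered namespace `Summit.SmoothPoincare4.SmoothPoincare4.Theorems` repeats a component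
set_option linter.dupNamespace false

open scoped Manifold ContDiff Topology ENNReal NNReal
open Set Filter MeasureTheory
open Literature.Geometry.Lorentzian Literature.Geometry.Riemannian

namespace Summit.SmoothPoincare4.SmoothPoincare4.Theorems

namespace EntropyTestFunctions

/-- `|s log s| ≤ s² + 1` for `s ≥ 0` (crude bound used for dominated convergence). -/
theorem abs_mul_log_le {s : ℝ} (hs : 0 ≤ s) : |s * Real.log s| ≤ s ^ 2 + 1 := by
  rcases hs.eq_or_lt with rfl | hpos
  · simp
  by_cases h1 : s ≤ 1
  · have := Real.abs_log_mul_self_lt s hpos h1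
    rw [mul_comm] at this
    nlinarith [this, sq_nonneg s]
  · have h1 : 1 < s := not_le.mp h1
    have hlog0 : 0 ≤ Real.log s := Real.log_nonneg h1.le
    have hlog1 : Real.log s ≤ s - 1 := Real.log_le_sub_one_of_pos hpos
    rw [abs_of_nonneg (mul_nonneg hpos.le hlog0)]
    nlinarith [mul_le_mul_of_nonneg_left hlog1 hpos.le]

variable {M : Type} [TopologicalSpace M]
  [ChartedSpace (EuclideanSpace ℝ (Fin 4)) M] [IsManifold (𝓡 4) ∞ M]
  (g : PseudoRiemannianMetric (𝓡 4) ∞ (EuclideanSpace ℝ (Fin 4)) (TangentSpace (𝓡 4) : M → Type _))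

omit [ChartedSpace (EuclideanSpace ℝ (Fin 4)) M] [IsManifold (𝓡 4) ∞ M] in
/-- A continuous real function on a compact space is bounded in absolute value. -/
theorem exists_abs_le_of_continuous [CompactSpace M] {F : M → ℝ} (hF : Continuous F) :
    ∃ C, 0 ≤ C ∧ ∀ x, |F x| ≤ C := by
  obtain ⟨C, hC⟩ := (isCompact_range hF).isBounded.exists_norm_le
  refine ⟨max C 0, le_max_right _ _, fun x ↦ ?_⟩
  have := hC (F x) ⟨x, rfl⟩
  rw [Real.norm_eq_abs] at this
  exact this.trans (le_max_left _ _)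

/-- **The pointwise comparison** behind the approximation: for `q = χ² + a` with `a > 0`,
`χ = s w`, `0 ≤ s ≤ 1`, and `f = 0 − log q`, at every point
`(τ(R + |∇f|²) + f − 4)·(c q) ≤ (τ(R q + 4|∇w|²) − q log q − 4 q)·c`
(equality except in the gradient term, where `|∇q|²/q = 4 s⁴ w² |∇w|²/q ≤ 4|∇w|²`). -/
theorem density_le [g.HasLeviCivita] (hg : g.IsRiemannian) {τ c s a : ℝ} (hτ : 0 < τ) (hc : 0 < c)
    (hs0 : 0 ≤ s)
    (hs1 : s ≤ 1) (ha : 0 < a) {w : M → ℝ} (hw : ContMDiff (𝓡 4) 𝓘(ℝ, ℝ) ∞ w) (x : M) :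
    (τ * (g.scalarCurvature x + g.gradSq (fun y ↦ 0 - Real.log ((s * w y) ^ 2 + a)) x)
        + (0 - Real.log ((s * w x) ^ 2 + a)) - 4) * (c * ((s * w x) ^ 2 + a))
      ≤ (τ * (g.scalarCurvature x * ((s * w x) ^ 2 + a) + 4 * g.gradSq w x)
        - ((s * w x) ^ 2 + a) * Real.log ((s * w x) ^ 2 + a) - 4 * ((s * w x) ^ 2 + a)) * c := by
  set q : M → ℝ := fun y ↦ (s * w y) ^ 2 + a with hq
  have hqpos : ∀ y, 0 < q y := fun y ↦ by positivity
  have hwd : MDifferentiableAt (𝓡 4) 𝓘(ℝ, ℝ) w x := (hw x).mdifferentiableAt (by simp)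
  have hχd : MDifferentiableAt (𝓡 4) 𝓘(ℝ, ℝ) (fun y ↦ s * w y) x :=
    (mdifferentiableAt_const (c := s)).mul hwd
  have hqd : MDifferentiableAt (𝓡 4) 𝓘(ℝ, ℝ) q x :=
    (hχd.mul hχd).add (mdifferentiableAt_const (c := a)) |>.congr_of_eventuallyEq
      (Eventually.of_forall fun y ↦ by simp [hq, sq])
  -- `|∇f|² = q⁻² |∇q|²`, `|∇q|² = 4 χ² |∇χ|²`, `|∇χ|² = s² |∇w|²`
  have hf : g.gradSq (fun y ↦ 0 - Real.log (q y)) x = (q x)⁻¹ ^ 2 * g.gradSq q x :=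
    g.gradSq_const_sub_log_comp 0 (hqpos x) hqd
  have hqg : g.gradSq q x = 4 * (s * w x) ^ 2 * g.gradSq (fun y ↦ s * w y) x :=
    g.gradSq_sq_add_const a hχd
  have hχg : g.gradSq (fun y ↦ s * w y) x = s ^ 2 * g.gradSq w x := by
    have := g.gradSq_real_comp (h := fun t : ℝ ↦ s * t) (h' := s) (φ := w)
      (by simpa using (hasDerivAt_id (w x)).const_mul s) hwd
    rw [show (fun y ↦ s * w y) = (fun t : ℝ ↦ s * t) ∘ w from rfl, this]
  have hG0 : 0 ≤ g.gradSq w x := g.gradSq_nonneg hg w x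
  -- the key inequality `q⁻¹ s⁴ w² ≤ 1`
  have hs2 : s ^ 2 ≤ 1 := by nlinarith
  have hkey : (q x)⁻¹ * (s ^ 2 * (s * w x) ^ 2) ≤ 1 := by
    rw [inv_mul_le_iff₀ (hqpos x), mul_one]
    have : s ^ 2 * (s * w x) ^ 2 ≤ 1 * (s * w x) ^ 2 :=
      mul_le_mul_of_nonneg_right hs2 (sq_nonneg _)
    simp only [hq]
    linarith
  change (τ * (g.scalarCurvature x + g.gradSq (fun y ↦ 0 - Real.log (q y)) x)
      + (0 - Real.log (q x)) - 4) * (c * q x)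
    ≤ (τ * (g.scalarCurvature x * q x + 4 * g.gradSq w x) - q x * Real.log (q x) - 4 * q x) * c
  rw [hf, hqg, hχg]
  have hqx : 0 < q x := hqpos x
  -- reduce to the gradient terms
  have hgrad : (q x)⁻¹ ^ 2 * (4 * (s * w x) ^ 2 * (s ^ 2 * g.gradSq w x)) * q x
      ≤ 4 * g.gradSq w x := by
    have : (q x)⁻¹ ^ 2 * (4 * (s * w x) ^ 2 * (s ^ 2 * g.gradSq w x)) * q x =
        4 * g.gradSq w x * ((q x)⁻¹ * (s ^ 2 * (s * w x) ^ 2)) := by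
      field_simp
    rw [this]
    nlinarith [hkey, hG0]
  nlinarith [hgrad, hτ, hc, mul_pos hτ hc]

omit [IsManifold (𝓡 4) ∞ M] in
/-- Smoothness of `y ↦ c₀ - log ((s w)² + a)` for `a > 0`. -/
theorem contMDiff_const_sub_log {s a : ℝ} (ha : 0 < a) (c₀ : ℝ) {w : M → ℝ}
    (hw : ContMDiff (𝓡 4) 𝓘(ℝ, ℝ) ∞ w) :
    ContMDiff (𝓡 4) 𝓘(ℝ, ℝ) ∞ (fun y ↦ c₀ - Real.log ((s * w y) ^ 2 + a)) := by
  have hq : ContMDiff (𝓡 4) 𝓘(ℝ, ℝ) ∞ (fun y ↦ (s * w y) ^ 2 + a) :=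
    ((contMDiff_const.mul hw).pow 2).add contMDiff_const
  have hlog : ContMDiff (𝓡 4) 𝓘(ℝ, ℝ) ∞ (fun y ↦ Real.log ((s * w y) ^ 2 + a)) := by
    intro x
    have hqx : ContMDiffAt (𝓡 4) 𝓘(ℝ, ℝ) ∞ (fun y ↦ (s * w y) ^ 2 + a) x := hq x
    have hne : (s * w x) ^ 2 + a ≠ 0 := by positivity
    exact (Real.contDiffAt_log.mpr hne).comp_contMDiffAt (f := fun y ↦ (s * w y) ^ 2 + a) hqx
  exact contMDiff_const.sub hlog

section Main

variable [CompactSpace M] [T3Space M] [MeasurableSpace M] [BorelSpace M]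

/-- A continuous real function on the closed manifold is integrable for `dV_g`. -/
theorem integrable_of_continuous' (hg : g.IsRiemannian) {F : M → ℝ} (hF : Continuous F) :
    Integrable F (riemannianMeasure (g.toContMDiffRiemannianMetric hg)) := by
  haveI := isFiniteMeasure_riemannianMeasure (g.toContMDiffRiemannianMetric hg)
  obtain ⟨C, -, hC⟩ := exists_abs_le_of_continuous (M := M) hF
  exact Integrable.of_bound hF.aestronglyMeasurable C (ae_of_all _ fun x ↦ by
    rw [Real.norm_eq_abs]; exact hC x)

/-- **The `f`-clause at `τ` implies the `w²`-clause at `τ`.** Let `g` be a smooth Riemannian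
metric (Levi-Civita) on a closed 4-manifold, `τ > 0`, `c = (4πτ)⁻²`, and suppose
`L ≤ 𝒲(g, f, τ) = ∫ [τ(R + |∇f|²) + f − 4] c e^{-f} dV` for every smooth `f` with `∫ c e^{-f} dV = 1`.
Then for every smooth `w` with `∫ c w² dV = 1` (zeros allowed),
`L ≤ ∫ [τ(R w² + 4|∇w|²) − w² log w² − 4 w²] c dV`.
Proof: `f_n = −log q_n`, `q_n = (1 − ε_n) w² + ε_n/V`, `V = ∫ c dV`, `ε_n = 1/(2(n+1))`; the
`f`-clause at `f_n`, the pointwise bound `density_le` (`|∇q|²/q ≤ 4|∇w|²`), and dominated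
convergence `q_n → w²`. Perelman 2002 §3.1; Topping 2006, proof of Lemma 8.3.5 ("by approximation"). -/
theorem wClause_sq_of_wClause_exp [g.HasLeviCivita] (hg : g.IsRiemannian) {L τ : ℝ} (hτ : 0 < τ)
    (hclause : ∀ f : M → ℝ, ContMDiff (𝓡 4) 𝓘(ℝ, ℝ) ∞ f →
      ∫ x, (4 * Real.pi * τ) ^ (-(4 : ℝ) / 2) * Real.exp (-f x)
        ∂(riemannianMeasure (g.toContMDiffRiemannianMetric hg)) = 1 →
      L ≤ ∫ x, (τ * (g.scalarCurvature x + g.gradSq f x) + f x - 4) *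
          ((4 * Real.pi * τ) ^ (-(4 : ℝ) / 2) * Real.exp (-f x))
        ∂(riemannianMeasure (g.toContMDiffRiemannianMetric hg)))
    {w : M → ℝ} (hw : ContMDiff (𝓡 4) 𝓘(ℝ, ℝ) ∞ w)
    (hnorm : ∫ x, (4 * Real.pi * τ) ^ (-(4 : ℝ) / 2) * w x ^ 2
      ∂(riemannianMeasure (g.toContMDiffRiemannianMetric hg)) = 1) :
    L ≤ ∫ x, (τ * (g.scalarCurvature x * w x ^ 2 + 4 * g.gradSq w x)
        - w x ^ 2 * Real.log (w x ^ 2) - 4 * w x ^ 2) * (4 * Real.pi * τ) ^ (-(4 : ℝ) / 2)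
      ∂(riemannianMeasure (g.toContMDiffRiemannianMetric hg)) := by
  set μ : Measure M := riemannianMeasure (g.toContMDiffRiemannianMetric hg) with hμ
  set c : ℝ := (4 * Real.pi * τ) ^ (-(4 : ℝ) / 2) with hc
  have hcpos : 0 < c := Real.rpow_pos_of_pos (by positivity) _
  haveI : IsFiniteMeasure μ := isFiniteMeasure_riemannianMeasure _
  -- continuity / bounds of the fixed data
  have hR : Continuous g.scalarCurvature := g.contMDiff_scalarCurvature.continuous
  have hG : Continuous (g.gradSq w) := (contMDiff_gradSq g hw).continuous
  have hwc : Continuous w := hw.continuous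
  have hG0 : ∀ x, 0 ≤ g.gradSq w x := fun x ↦ g.gradSq_nonneg hg w x
  obtain ⟨CR, hCR0, hCR⟩ := exists_abs_le_of_continuous (M := M) hR
  obtain ⟨CG, hCG0, hCG⟩ := exists_abs_le_of_continuous (M := M) hG
  obtain ⟨Cw, hCw0, hCw⟩ := exists_abs_le_of_continuous (M := M) hwc
  -- `V = ∫ c dV > 0`
  have hμ0 : μ univ ≠ 0 := by
    intro h0
    have hzero : μ = 0 := Measure.measure_univ_eq_zero.mp h0
    rw [hzero, integral_zero_measure] at hnorm
    exact zero_ne_one hnorm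
  set V : ℝ := ∫ _x, c ∂μ with hV
  have hVeq : V = μ.real univ * c := by rw [hV, integral_const, smul_eq_mul]
  have hVpos : 0 < V := by
    rw [hVeq, measureReal_def]
    exact mul_pos (ENNReal.toReal_pos hμ0 (measure_ne_top μ _)) hcpos
  -- the sequence `ε_n = 1/(2(n+1))`, `s_n = √(1 − ε_n)`, `a_n = ε_n / V`
  set ε : ℕ → ℝ := fun n ↦ 1 / 2 * (1 / ((n : ℝ) + 1)) with hε
  have hε0 : ∀ n, 0 < ε n := fun n ↦ by positivity
  have hε1 : ∀ n, ε n ≤ 1 / 2 := fun n ↦ by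
    have h1 : 1 / ((n : ℝ) + 1) ≤ 1 := by
      rw [div_le_one (by positivity)]
      linarith [n.cast_nonneg (α := ℝ)]
    simp only [hε]
    linarith
  have hεlim : Tendsto ε atTop (𝓝 0) := by
    show Tendsto (fun n : ℕ ↦ (1 / 2 : ℝ) * (1 / ((n : ℝ) + 1))) atTop (𝓝 0)
    have := tendsto_one_div_add_atTop_nhds_zero_nat.const_mul (1 / 2 : ℝ)
    simpa using this
  set s : ℕ → ℝ := fun n ↦ Real.sqrt (1 - ε n) with hs
  set a : ℕ → ℝ := fun n ↦ ε n / V with ha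
  have ha0 : ∀ n, 0 < a n := fun n ↦ div_pos (hε0 n) hVpos
  have hs0 : ∀ n, 0 ≤ s n := fun n ↦ Real.sqrt_nonneg _
  have hs2 : ∀ n, s n ^ 2 = 1 - ε n := fun n ↦ Real.sq_sqrt (by linarith [hε1 n])
  have hs1 : ∀ n, s n ≤ 1 := fun n ↦ by
    rw [hs, Real.sqrt_le_one]
    linarith [hε0 n]
  -- the regularised densities `q_n = (s_n w)² + a_n = (1 − ε_n) w² + ε_n/V`
  have hq_eq : ∀ n x, (s n * w x) ^ 2 + a n = (1 - ε n) * w x ^ 2 + ε n / V := fun n x ↦ by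
    rw [mul_pow, hs2]
  have hqpos : ∀ n x, 0 < (s n * w x) ^ 2 + a n := fun n x ↦ by positivity
  have hqle : ∀ n x, (s n * w x) ^ 2 + a n ≤ Cw ^ 2 + 1 / V := fun n x ↦ by
    rw [hq_eq]
    have hw2 : w x ^ 2 ≤ Cw ^ 2 := by
      have := hCw x
      rw [abs_le] at this
      nlinarith
    have h1 : (1 - ε n) * w x ^ 2 ≤ Cw ^ 2 := by nlinarith [hε0 n, hε1 n, sq_nonneg (w x)]
    have h2 : ε n / V ≤ 1 / V := div_le_div_of_nonneg_right (by linarith [hε1 n]) hVpos.le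
    linarith
  -- the test functions `f_n = 0 − log q_n`
  have hf : ∀ n, ContMDiff (𝓡 4) 𝓘(ℝ, ℝ) ∞ (fun y ↦ 0 - Real.log ((s n * w y) ^ 2 + a n)) :=
    fun n ↦ contMDiff_const_sub_log (ha0 n) 0 hw
  have hexp : ∀ n x, Real.exp (-(0 - Real.log ((s n * w x) ^ 2 + a n))) = (s n * w x) ^ 2 + a n :=
    fun n x ↦ by rw [zero_sub, neg_neg, Real.exp_log (hqpos n x)]
  -- normalisation of `f_n`
  have hIw2 : Integrable (fun x ↦ c * w x ^ 2) μ :=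
    integrable_of_continuous' g hg (continuous_const.mul (hwc.pow 2))
  have hnorm_n : ∀ n, ∫ x, c * Real.exp (-(0 - Real.log ((s n * w x) ^ 2 + a n))) ∂μ = 1 := by
    intro n
    have h1 : ∫ x, c * Real.exp (-(0 - Real.log ((s n * w x) ^ 2 + a n))) ∂μ =
        ∫ x, ((1 - ε n) * (c * w x ^ 2) + a n * c) ∂μ := by
      refine integral_congr_ae (ae_of_all _ fun x ↦ ?_)
      show c * Real.exp (-(0 - Real.log ((s n * w x) ^ 2 + a n))) = (1 - ε n) * (c * w x ^ 2) + a n * c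
      rw [hexp n x, hq_eq n x]
      simp only [ha]
      ring
    rw [h1, integral_add (hIw2.const_mul _) (integrable_const _), integral_const_mul, hnorm,
      integral_const, smul_eq_mul]
    have hVne : μ.real univ * c ≠ 0 := by rw [← hVeq]; exact hVpos.ne'
    have hcne : c ≠ 0 := hcpos.ne'
    have hμr : μ.real univ ≠ 0 := left_ne_zero_of_mul hVne
    have hane : a n = ε n / (μ.real univ * c) := by rw [ha, hVeq]
    rw [hane]
    field_simp
    ring
  -- `L ≤ B_n`
  set F : ℕ → M → ℝ := fun n x ↦ (τ * (g.scalarCurvature x * ((s n * w x) ^ 2 + a n)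
      + 4 * g.gradSq w x) - ((s n * w x) ^ 2 + a n) * Real.log ((s n * w x) ^ 2 + a n)
      - 4 * ((s n * w x) ^ 2 + a n)) * c with hF
  have hFcont : ∀ n, Continuous (F n) := by
    intro n
    have hq : Continuous fun x ↦ (s n * w x) ^ 2 + a n :=
      ((continuous_const.mul hwc).pow 2).add continuous_const
    have hlog : Continuous fun x ↦ ((s n * w x) ^ 2 + a n) * Real.log ((s n * w x) ^ 2 + a n) :=
      Real.continuous_mul_log.comp hq
    have h1 : Continuous fun x ↦ τ * (g.scalarCurvature x * ((s n * w x) ^ 2 + a n)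
        + 4 * g.gradSq w x) := continuous_const.mul ((hR.mul hq).add (continuous_const.mul hG))
    exact ((h1.sub hlog).sub (continuous_const.mul hq)).mul continuous_const
  have hL : ∀ n, L ≤ ∫ x, F n x ∂μ := by
    intro n
    have h1 := hclause _ (hf n) (hnorm_n n)
    refine h1.trans (integral_mono_ae ?_ (integrable_of_continuous' g hg (hFcont n))
      (ae_of_all _ fun x ↦ ?_))
    · -- integrability of the `f_n`-density (continuous)
      have hfc : Continuous fun x ↦ 0 - Real.log ((s n * w x) ^ 2 + a n) := (hf n).continuous
      have hGf : Continuous (g.gradSq fun y ↦ 0 - Real.log ((s n * w y) ^ 2 + a n)) :=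
        (contMDiff_gradSq g (hf n)).continuous
      have hE : Continuous fun x ↦ Real.exp (-(0 - Real.log ((s n * w x) ^ 2 + a n))) :=
        Real.continuous_exp.comp hfc.neg
      exact integrable_of_continuous' g hg
        ((((continuous_const.mul (hR.add hGf)).add hfc).sub continuous_const).mul
          (continuous_const.mul hE))
    · simp only [hF, hexp]
      exact density_le g hg hτ hcpos (hs0 n) (hs1 n) (ha0 n) hw x
  -- dominated convergence `B_n → 𝒲(w)`
  set K : ℝ := (τ * (CR * (Cw ^ 2 + 1 / V) + 4 * CG) + ((Cw ^ 2 + 1 / V) ^ 2 + 1)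
    + 4 * (Cw ^ 2 + 1 / V)) * c with hK
  have hbound : ∀ n x, |F n x| ≤ K := by
    intro n x
    set qx := (s n * w x) ^ 2 + a n with hqx
    have hq0 : 0 < qx := hqpos n x
    have hqS : qx ≤ Cw ^ 2 + 1 / V := hqle n x
    have hRx := hCR x
    have hGx : |g.gradSq w x| ≤ CG := hCG x
    rw [abs_of_nonneg (hG0 x)] at hGx
    have h1 : |g.scalarCurvature x * qx| ≤ CR * (Cw ^ 2 + 1 / V) := by
      rw [abs_mul, abs_of_pos hq0]
      exact mul_le_mul hRx hqS hq0.le hCR0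
    have h2 : |qx * Real.log qx| ≤ (Cw ^ 2 + 1 / V) ^ 2 + 1 := by
      refine (abs_mul_log_le hq0.le).trans ?_
      nlinarith [hqS, hq0]
    have h3 : |τ * (g.scalarCurvature x * qx + 4 * g.gradSq w x) - qx * Real.log qx - 4 * qx|
        ≤ τ * (CR * (Cw ^ 2 + 1 / V) + 4 * CG) + ((Cw ^ 2 + 1 / V) ^ 2 + 1)
          + 4 * (Cw ^ 2 + 1 / V) := by
      have hA : |τ * (g.scalarCurvature x * qx + 4 * g.gradSq w x)|
          ≤ τ * (CR * (Cw ^ 2 + 1 / V) + 4 * CG) := by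
        rw [abs_mul, abs_of_pos hτ]
        refine mul_le_mul_of_nonneg_left ((abs_add_le _ _).trans (add_le_add h1 ?_)) hτ.le
        rw [abs_mul, abs_of_pos (by norm_num : (0 : ℝ) < 4), abs_of_nonneg (hG0 x)]
        linarith
      have hB : |4 * qx| ≤ 4 * (Cw ^ 2 + 1 / V) := by
        rw [abs_mul, abs_of_pos (by norm_num : (0 : ℝ) < 4), abs_of_pos hq0]
        linarith
      calc _ ≤ |τ * (g.scalarCurvature x * qx + 4 * g.gradSq w x) - qx * Real.log qx| + |4 * qx| :=
            abs_sub _ _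
        _ ≤ |τ * (g.scalarCurvature x * qx + 4 * g.gradSq w x)| + |qx * Real.log qx| + |4 * qx| :=
            by gcongr; exact abs_sub _ _
        _ ≤ _ := by linarith
    simp only [hF, hK]
    rw [abs_mul, abs_of_pos hcpos]
    exact mul_le_mul_of_nonneg_right h3 hcpos.le
  have hlimq : ∀ x, Tendsto (fun n ↦ (s n * w x) ^ 2 + a n) atTop (𝓝 (w x ^ 2)) := by
    intro x
    have h : Tendsto (fun n ↦ (1 - ε n) * w x ^ 2 + ε n / V) atTop (𝓝 ((1 - 0) * w x ^ 2 + 0 / V)) :=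
      ((tendsto_const_nhds.sub hεlim).mul tendsto_const_nhds).add (hεlim.div_const V)
    simp only [sub_zero, one_mul, zero_div, add_zero] at h
    exact h.congr fun n ↦ (hq_eq n x).symm
  have hlimF : ∀ x, Tendsto (fun n ↦ F n x) atTop
      (𝓝 ((τ * (g.scalarCurvature x * w x ^ 2 + 4 * g.gradSq w x)
        - w x ^ 2 * Real.log (w x ^ 2) - 4 * w x ^ 2) * c)) := by
    intro x
    have hΦ : Continuous fun q : ℝ ↦ (τ * (g.scalarCurvature x * q + 4 * g.gradSq w x)
        - q * Real.log q - 4 * q) * c :=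
      (((continuous_const.mul ((continuous_const.mul continuous_id).add continuous_const)).sub
        Real.continuous_mul_log).sub (continuous_const.mul continuous_id)).mul continuous_const
    exact (hΦ.tendsto (w x ^ 2)).comp (hlimq x)
  have hlim : Tendsto (fun n ↦ ∫ x, F n x ∂μ) atTop
      (𝓝 (∫ x, (τ * (g.scalarCurvature x * w x ^ 2 + 4 * g.gradSq w x)
        - w x ^ 2 * Real.log (w x ^ 2) - 4 * w x ^ 2) * c ∂μ)) :=
    tendsto_integral_of_dominated_convergence (fun _ ↦ K)
      (fun n ↦ (hFcont n).aestronglyMeasurable) (integrable_const K)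
      (fun n ↦ ae_of_all _ fun x ↦ by rw [Real.norm_eq_abs]; exact hbound n x)
      (ae_of_all _ hlimF)
  exact ge_of_tendsto' hlim hL

end Main

end EntropyTestFunctions

/-- **The `f`-clause at `τ` implies the `w²`-clause at `τ`, registered form** (summit binder,
explicit arguments; see `EntropyTestFunctions.wClause_sq_of_wClause_exp`). Helper H2 for stub
`stub_conformalGluing` of line `green-blowup-conformal-entropy` (crux stmt-SmoothPoincare4-10871).
Perelman 2002 §3.1; Topping 2006, proof of Lemma 8.3.5. -/
theorem wClause_sq_of_wClause_exp :
    ∀ (M : Type) [TopologicalSpace M] [T2Space M] [SecondCountableTopology M]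
      [ChartedSpace (EuclideanSpace ℝ (Fin 4)) M] [IsManifold (𝓡 4) ∞ M] [CompactSpace M]
      [T3Space M] [MeasurableSpace M] [BorelSpace M]
      (g : PseudoRiemannianMetric (𝓡 4) ∞ (EuclideanSpace ℝ (Fin 4)) (TangentSpace (𝓡 4) : M → Type _))
      [g.HasLeviCivita] (hg : g.IsRiemannian) (L τ : ℝ), 0 < τ →
      (∀ f : M → ℝ, ContMDiff (𝓡 4) 𝓘(ℝ, ℝ) ∞ f →
        ∫ x, (4 * Real.pi * τ) ^ (-(4 : ℝ) / 2) * Real.exp (-f x)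
          ∂(riemannianMeasure (g.toContMDiffRiemannianMetric hg)) = 1 →
        L ≤ ∫ x, (τ * (g.scalarCurvature x + g.gradSq f x) + f x - 4) *
            ((4 * Real.pi * τ) ^ (-(4 : ℝ) / 2) * Real.exp (-f x))
          ∂(riemannianMeasure (g.toContMDiffRiemannianMetric hg))) →
      ∀ (w : M → ℝ), ContMDiff (𝓡 4) 𝓘(ℝ, ℝ) ∞ w →
        ∫ x, (4 * Real.pi * τ) ^ (-(4 : ℝ) / 2) * w x ^ 2
          ∂(riemannianMeasure (g.toContMDiffRiemannianMetric hg)) = 1 →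
        L ≤ ∫ x, (τ * (g.scalarCurvature x * w x ^ 2 + 4 * g.gradSq w x)
            - w x ^ 2 * Real.log (w x ^ 2) - 4 * w x ^ 2) * (4 * Real.pi * τ) ^ (-(4 : ℝ) / 2)
          ∂(riemannianMeasure (g.toContMDiffRiemannianMetric hg)) := by
  intro M _ _ _ _ _ _ _ _ _ g _ hg L τ hτ hclause w hw hnorm
  exact EntropyTestFunctions.wClause_sq_of_wClause_exp g hg hτ hclause hw hnorm

end Summit.SmoothPoincare4.SmoothPoincare4.Theorems

end
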